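import Summits.NavierStokesRegularity.NavierStokesRegularity.Theorems.SymmetryModuliCountForcedSymmetrySensitiveClosingShape
import Summits.NavierStokesRegularity.NavierStokesRegularity.Theorems.SymmetryModuliCountForcedSymmetryStubHullMinimal
import Summits.NavierStokesRegularity.NavierStokesRegularity.Theorems.SymmetryModuliCountForcedSymmetryStubHullSensitive
import Summits.NavierStokesRegularity.NavierStokesRegularity.Theorems.SymmetryModuliCountForcedSymmetryStubHullAlmostPeriodic
import HarnessLib

/-!
# Crux `ForcedSymmetry` (stmt-NavierStokesRegularity-4052), line `closing-dichotomy` gen c10.2 — the hull-canonical split has no slack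

Support file (`--supports stmt-NavierStokesRegularity-4052`; lead c10).  Skeleton gen c10.1/c10.2
(`Cruxes/ForcedSymmetry/Lines/closing_dichotomy.lean`) re-typed the two research residuals of the line by the isomorphism class of
the minimal HULL `H(U)` of the recurrent singular profile `U` under the Navier–Stokes scaling flow in `L³_loc({t ≤ 0} × ℝ³)`:

* `SensitiveHullLiouville` — a slab class profile (suitable weak, weak gradient, `𝐈 < ∞`, rate `C`) that is uniformly
  scaling-recurrent, NOT rotated-discretely self-similar (stmt-8561's clause) and whose hull is a SENSITIVE MINIMAL SET (every
  `L³_loc` hull point has the profile in its own hull and is orbit-sensitive at itself with one constant `δ` on `Q(0,1)`) is regular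
  at the origin;
* `AlmostPeriodicHullLiouville` — a slab class profile whose scaling orbit is almost periodic along itself, NOT rotated-discretely
  self-similar, and whose hull is minimal with every hull point almost periodic along its orbit (an EQUICONTINUOUS minimal hull that
  is not a closed orbit) is regular at the origin.

The three hull theorems of wave 1 (`stub_hullMinimal` p158041 — Furstenberg 1.17 in `L³_loc`; `stub_hullSensitive` p159198 —
Auslander–Yorke propagation; `stub_hullAlmostPeriodic` p158194 — inheritance of almost periods) discharge the hull clauses, so the
re-typing adds NO SLACK: this file proves

* `sensitiveHullLiouville_of_sensitiveLiouville`, `almostPeriodicHullLiouville_of_almostPeriodicLiouville` — the gen c10 parts are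
  IMPLIED by the gen c9.4 parts (pure logic: instantiate the hull clause at `V = u`, resp. drop it);
* `typeIAncientLiouville_of_hullLiouvilleParts` — `SensitiveHullLiouville → AlmostPeriodicHullLiouville → RDSSLiouvilleInClass → X`
  (the skeleton's composition with the landed hull theorems, importable);
* `forcedSymmetry_iff_hullLiouvilleParts` — **`ForcedSymmetry ↔ (SensitiveHullLiouville ∧ AlmostPeriodicHullLiouville ∧
  RDSSLiouvilleInClass)`**, the hull-canonical THREE LIOUVILLE THEOREMS certificate (periodic / equicontinuous / sensitive minimal
  hull), refining `forcedSymmetry_iff_liouvilleParts` (p155499).  For the planner's `--split` (census v3 §R9/§R11) these are the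
  recommended signatures of the two 4052-owned children (= the registered stubs `stub_sensitiveHullLiouville`,
  `stub_almostPeriodicHullLiouville` verbatim); the third child is stmt-8561 verbatim.

## References

* J. Auslander, J. Yorke, Tôhoku Math. J. 32 (1980), 177–188, doi:10.2748/tmj/1178229634, Thm 1. [AuslanderYorke1980]
* E. Akin, J. Auslander, K. Berg, in: Convergence in Ergodic Theory and Probability (1996), 25–40, Thm 2.4–2.5. [AkinAuslanderBerg1996]
* H. Furstenberg, Recurrence in Ergodic Theory and Combinatorial Number Theory (1981), Ch. 1 §4, Thm 1.17. [Furstenberg1981]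
* D. Albritton, T. Barker, J. Math. Fluid Mech. 21 (2019), Lemma 2.2, Prop. 2.3, §3. [AlbrittonBarker2019]
-/

noncomputable section

-- the sub-problem namespace repeats the summit name (D-0017 layout `Summit.<S>.<P>.Theorems`)
set_option linter.dupNamespace false

open MeasureTheory Set Filter Topology Function

namespace Summit.NavierStokesRegularity.NavierStokesRegularity.Theorems.SymmetryModuliCountForcedSymmetry

open Literature.Analysis.FluidPDE Metric
open scoped ENNReal

/-- **`SensitiveLiouville → SensitiveHullLiouville`** (pure logic): the hull clause of the gen c10 form, instantiated at the
profile itself (`V = u`, a hull point of itself with `τ = 0`, and in `L³_loc` by `memLp_three_of_slabProfile`), yields gen c9.4's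
pointwise orbit-sensitivity hypothesis. [folklore] -/
theorem sensitiveHullLiouville_of_sensitiveLiouville :
    (∀ (u : ℝ → EuclideanSpace ℝ (Fin 3) → EuclideanSpace ℝ (Fin 3)) (p : ℝ → EuclideanSpace ℝ (Fin 3) → ℝ) (G : ℝ → EuclideanSpace ℝ (Fin 3) → EuclideanSpace ℝ (Fin 3) →L[ℝ] EuclideanSpace ℝ (Fin 3)) (C : ℝ),
      IsSuitableWeakSolutionOn (slab (EuclideanSpace ℝ (Fin 3)) (Set.Iio 0) isOpen_Iio) 1 0 u p →
      HasWeakSpatialGradientOn (slab (EuclideanSpace ℝ (Fin 3)) (Set.Iio 0) isOpen_Iio) u G →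
      typeIBound (Set.Iio (0 : ℝ) ×ˢ Set.univ) u p G < ⊤ →
      HasTypeITimeDecay C u →
      (∀ ε : ℝ, 0 < ε → ∀ K : Set (ℝ × EuclideanSpace ℝ (Fin 3)), IsCompact K → K ⊆ Set.Iic (0 : ℝ) ×ˢ Set.univ →
        ∃ L : ℝ, 0 < L ∧ ∀ a : ℝ, ∃ σ ∈ Set.Icc a (a + L),
          eLpNorm (fun z : ℝ × EuclideanSpace ℝ (Fin 3) => nsRescale (Real.exp σ) u z.1 z.2 - u z.1 z.2) 3
            (volume.restrict K) ≤ ENNReal.ofReal ε) →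
      (¬ ∃ l : ℝ, 1 < l ∧ ∃ (R : EuclideanSpace ℝ (Fin 3) ≃ₗᵢ[ℝ] EuclideanSpace ℝ (Fin 3)) (ξ : EuclideanSpace ℝ (Fin 3)) (τ : ℝ), τ ≤ 0 ∧
          (fun z : ℝ × EuclideanSpace ℝ (Fin 3) => l • R.symm (u (l ^ 2 * z.1 + τ) (l • R z.2 + ξ)))
            =ᵐ[volume.restrict (Set.Iio (0 : ℝ) ×ˢ Set.univ)] (fun z : ℝ × EuclideanSpace ℝ (Fin 3) => u z.1 z.2)) →
      (∃ δ : ℝ, 0 < δ ∧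
        ∀ ε : ℝ, 0 < ε → ∀ K : Set (ℝ × EuclideanSpace ℝ (Fin 3)), IsCompact K → K ⊆ Set.Iic (0 : ℝ) ×ˢ Set.univ →
          ∃ σ : ℝ, eLpNorm (fun z : ℝ × EuclideanSpace ℝ (Fin 3) => nsRescale (Real.exp σ) u z.1 z.2 - u z.1 z.2) 3
              (volume.restrict K) ≤ ENNReal.ofReal ε ∧
            ∃ s : ℝ, ENNReal.ofReal δ < eLpNorm (fun z : ℝ × EuclideanSpace ℝ (Fin 3) =>
                nsRescale (Real.exp σ) (nsRescale (Real.exp s) u) z.1 z.2 - nsRescale (Real.exp s) u z.1 z.2) 3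
              (volume.restrict (parabolicCylinder 1 (0 : ℝ × EuclideanSpace ℝ (Fin 3))))) →
      ¬ IsBackwardSingularPoint u 0) →
    (∀ (u : ℝ → EuclideanSpace ℝ (Fin 3) → EuclideanSpace ℝ (Fin 3)) (p : ℝ → EuclideanSpace ℝ (Fin 3) → ℝ) (G : ℝ → EuclideanSpace ℝ (Fin 3) → EuclideanSpace ℝ (Fin 3) →L[ℝ] EuclideanSpace ℝ (Fin 3)) (C : ℝ),
      IsSuitableWeakSolutionOn (slab (EuclideanSpace ℝ (Fin 3)) (Set.Iio 0) isOpen_Iio) 1 0 u p →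
      HasWeakSpatialGradientOn (slab (EuclideanSpace ℝ (Fin 3)) (Set.Iio 0) isOpen_Iio) u G →
      typeIBound (Set.Iio (0 : ℝ) ×ˢ Set.univ) u p G < ⊤ →
      HasTypeITimeDecay C u →
      (∀ ε : ℝ, 0 < ε → ∀ K : Set (ℝ × EuclideanSpace ℝ (Fin 3)), IsCompact K → K ⊆ Set.Iic (0 : ℝ) ×ˢ Set.univ →
        ∃ L : ℝ, 0 < L ∧ ∀ a : ℝ, ∃ σ ∈ Set.Icc a (a + L),
          eLpNorm (fun z : ℝ × EuclideanSpace ℝ (Fin 3) => nsRescale (Real.exp σ) u z.1 z.2 - u z.1 z.2) 3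
            (volume.restrict K) ≤ ENNReal.ofReal ε) →
      (¬ ∃ l : ℝ, 1 < l ∧ ∃ (R : EuclideanSpace ℝ (Fin 3) ≃ₗᵢ[ℝ] EuclideanSpace ℝ (Fin 3)) (ξ : EuclideanSpace ℝ (Fin 3)) (τ : ℝ), τ ≤ 0 ∧
          (fun z : ℝ × EuclideanSpace ℝ (Fin 3) => l • R.symm (u (l ^ 2 * z.1 + τ) (l • R z.2 + ξ)))
            =ᵐ[volume.restrict (Set.Iio (0 : ℝ) ×ˢ Set.univ)] (fun z : ℝ × EuclideanSpace ℝ (Fin 3) => u z.1 z.2)) →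
      (∃ δ : ℝ, 0 < δ ∧ ∀ V : ℝ → EuclideanSpace ℝ (Fin 3) → EuclideanSpace ℝ (Fin 3),
        (∀ R : ℝ, 0 < R → MemLp (uncurry V) 3 (volume.restrict (parabolicCylinder R (0 : ℝ × EuclideanSpace ℝ (Fin 3))))) →
        (∀ ε : ℝ, 0 < ε → ∀ K : Set (ℝ × EuclideanSpace ℝ (Fin 3)), IsCompact K → K ⊆ Set.Iic (0 : ℝ) ×ˢ Set.univ →
          ∃ τ : ℝ, eLpNorm (fun z : ℝ × EuclideanSpace ℝ (Fin 3) => nsRescale (Real.exp τ) u z.1 z.2 - V z.1 z.2) 3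
            (volume.restrict K) ≤ ENNReal.ofReal ε) →
        (∀ ε : ℝ, 0 < ε → ∀ K : Set (ℝ × EuclideanSpace ℝ (Fin 3)), IsCompact K → K ⊆ Set.Iic (0 : ℝ) ×ˢ Set.univ →
          ∃ τ : ℝ, eLpNorm (fun z : ℝ × EuclideanSpace ℝ (Fin 3) => nsRescale (Real.exp τ) V z.1 z.2 - u z.1 z.2) 3
            (volume.restrict K) ≤ ENNReal.ofReal ε) ∧
        (∀ ε : ℝ, 0 < ε → ∀ K : Set (ℝ × EuclideanSpace ℝ (Fin 3)), IsCompact K → K ⊆ Set.Iic (0 : ℝ) ×ˢ Set.univ →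
          ∃ σ : ℝ, eLpNorm (fun z : ℝ × EuclideanSpace ℝ (Fin 3) => nsRescale (Real.exp σ) V z.1 z.2 - V z.1 z.2) 3
              (volume.restrict K) ≤ ENNReal.ofReal ε ∧
            ∃ s : ℝ, ENNReal.ofReal δ < eLpNorm (fun z : ℝ × EuclideanSpace ℝ (Fin 3) =>
                nsRescale (Real.exp σ) (nsRescale (Real.exp s) V) z.1 z.2 - nsRescale (Real.exp s) V z.1 z.2) 3
              (volume.restrict (parabolicCylinder 1 (0 : ℝ × EuclideanSpace ℝ (Fin 3)))))) →
      ¬ IsBackwardSingularPoint u 0) := by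
  intro hSL u p G C hsw hwg hI hdec hrec hnr hH
  obtain ⟨δ, hδ, hHull⟩ := hH
  have hPu : ∀ R : ℝ, 0 < R → MemLp (uncurry u) 3 (volume.restrict (parabolicCylinder R (0 : ℝ × EuclideanSpace ℝ (Fin 3)))) :=
    fun R hR => Summit.NavierStokesRegularity.NavierStokesRegularity.Theorems.memLp_three_of_slabProfile hwg hI hR
  have hself : ∀ ε : ℝ, 0 < ε → ∀ K : Set (ℝ × EuclideanSpace ℝ (Fin 3)), IsCompact K → K ⊆ Set.Iic (0 : ℝ) ×ˢ Set.univ →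
      ∃ τ : ℝ, eLpNorm (fun z : ℝ × EuclideanSpace ℝ (Fin 3) => nsRescale (Real.exp τ) u z.1 z.2 - u z.1 z.2) 3
        (volume.restrict K) ≤ ENNReal.ofReal ε := by
    intro ε _hε K _hK _hKH
    refine ⟨0, ?_⟩
    have h0 : (fun z : ℝ × EuclideanSpace ℝ (Fin 3) => nsRescale (Real.exp 0) u z.1 z.2 - u z.1 z.2) = 0 := by
      funext z
      simp [Real.exp_zero, nsRescale_apply]
    rw [h0, eLpNorm_zero]
    exact zero_le
  obtain ⟨-, hOS⟩ := hHull u hPu hself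
  exact hSL u p G C hsw hwg hI hdec hrec hnr ⟨δ, hδ, hOS⟩

/-- **`AlmostPeriodicLiouville → AlmostPeriodicHullLiouville`** (pure logic: the gen c10 form has all hypotheses of the gen
c9.4 form, plus the hull clause, which is dropped). [folklore] -/
theorem almostPeriodicHullLiouville_of_almostPeriodicLiouville :
    (∀ (u : ℝ → EuclideanSpace ℝ (Fin 3) → EuclideanSpace ℝ (Fin 3)) (p : ℝ → EuclideanSpace ℝ (Fin 3) → ℝ) (G : ℝ → EuclideanSpace ℝ (Fin 3) → EuclideanSpace ℝ (Fin 3) →L[ℝ] EuclideanSpace ℝ (Fin 3)) (C : ℝ),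
      IsSuitableWeakSolutionOn (slab (EuclideanSpace ℝ (Fin 3)) (Set.Iio 0) isOpen_Iio) 1 0 u p →
      HasWeakSpatialGradientOn (slab (EuclideanSpace ℝ (Fin 3)) (Set.Iio 0) isOpen_Iio) u G →
      typeIBound (Set.Iio (0 : ℝ) ×ˢ Set.univ) u p G < ⊤ →
      HasTypeITimeDecay C u →
      (∀ ε : ℝ, 0 < ε → ∀ K : Set (ℝ × EuclideanSpace ℝ (Fin 3)), IsCompact K → K ⊆ Set.Iic (0 : ℝ) ×ˢ Set.univ →
        ∃ L : ℝ, 0 < L ∧ ∀ a : ℝ, ∃ σ ∈ Set.Icc a (a + L), ∀ s : ℝ,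
          eLpNorm (fun z : ℝ × EuclideanSpace ℝ (Fin 3) =>
              nsRescale (Real.exp σ) (nsRescale (Real.exp s) u) z.1 z.2 - nsRescale (Real.exp s) u z.1 z.2) 3
            (volume.restrict K) ≤ ENNReal.ofReal ε) →
      (¬ ∃ l : ℝ, 1 < l ∧ ∃ (R : EuclideanSpace ℝ (Fin 3) ≃ₗᵢ[ℝ] EuclideanSpace ℝ (Fin 3)) (ξ : EuclideanSpace ℝ (Fin 3)) (τ : ℝ), τ ≤ 0 ∧
          (fun z : ℝ × EuclideanSpace ℝ (Fin 3) => l • R.symm (u (l ^ 2 * z.1 + τ) (l • R z.2 + ξ)))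
            =ᵐ[volume.restrict (Set.Iio (0 : ℝ) ×ˢ Set.univ)] (fun z : ℝ × EuclideanSpace ℝ (Fin 3) => u z.1 z.2)) →
      ¬ IsBackwardSingularPoint u 0) →
    (∀ (u : ℝ → EuclideanSpace ℝ (Fin 3) → EuclideanSpace ℝ (Fin 3)) (p : ℝ → EuclideanSpace ℝ (Fin 3) → ℝ) (G : ℝ → EuclideanSpace ℝ (Fin 3) → EuclideanSpace ℝ (Fin 3) →L[ℝ] EuclideanSpace ℝ (Fin 3)) (C : ℝ),
      IsSuitableWeakSolutionOn (slab (EuclideanSpace ℝ (Fin 3)) (Set.Iio 0) isOpen_Iio) 1 0 u p →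
      HasWeakSpatialGradientOn (slab (EuclideanSpace ℝ (Fin 3)) (Set.Iio 0) isOpen_Iio) u G →
      typeIBound (Set.Iio (0 : ℝ) ×ˢ Set.univ) u p G < ⊤ →
      HasTypeITimeDecay C u →
      (∀ ε : ℝ, 0 < ε → ∀ K : Set (ℝ × EuclideanSpace ℝ (Fin 3)), IsCompact K → K ⊆ Set.Iic (0 : ℝ) ×ˢ Set.univ →
        ∃ L : ℝ, 0 < L ∧ ∀ a : ℝ, ∃ σ ∈ Set.Icc a (a + L), ∀ s : ℝ,
          eLpNorm (fun z : ℝ × EuclideanSpace ℝ (Fin 3) =>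
              nsRescale (Real.exp σ) (nsRescale (Real.exp s) u) z.1 z.2 - nsRescale (Real.exp s) u z.1 z.2) 3
            (volume.restrict K) ≤ ENNReal.ofReal ε) →
      (¬ ∃ l : ℝ, 1 < l ∧ ∃ (R : EuclideanSpace ℝ (Fin 3) ≃ₗᵢ[ℝ] EuclideanSpace ℝ (Fin 3)) (ξ : EuclideanSpace ℝ (Fin 3)) (τ : ℝ), τ ≤ 0 ∧
          (fun z : ℝ × EuclideanSpace ℝ (Fin 3) => l • R.symm (u (l ^ 2 * z.1 + τ) (l • R z.2 + ξ)))
            =ᵐ[volume.restrict (Set.Iio (0 : ℝ) ×ˢ Set.univ)] (fun z : ℝ × EuclideanSpace ℝ (Fin 3) => u z.1 z.2)) →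
      (∀ V : ℝ → EuclideanSpace ℝ (Fin 3) → EuclideanSpace ℝ (Fin 3),
        (∀ R : ℝ, 0 < R → MemLp (uncurry V) 3 (volume.restrict (parabolicCylinder R (0 : ℝ × EuclideanSpace ℝ (Fin 3))))) →
        (∀ ε : ℝ, 0 < ε → ∀ K : Set (ℝ × EuclideanSpace ℝ (Fin 3)), IsCompact K → K ⊆ Set.Iic (0 : ℝ) ×ˢ Set.univ →
          ∃ τ : ℝ, eLpNorm (fun z : ℝ × EuclideanSpace ℝ (Fin 3) => nsRescale (Real.exp τ) u z.1 z.2 - V z.1 z.2) 3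
            (volume.restrict K) ≤ ENNReal.ofReal ε) →
        (∀ ε : ℝ, 0 < ε → ∀ K : Set (ℝ × EuclideanSpace ℝ (Fin 3)), IsCompact K → K ⊆ Set.Iic (0 : ℝ) ×ˢ Set.univ →
          ∃ τ : ℝ, eLpNorm (fun z : ℝ × EuclideanSpace ℝ (Fin 3) => nsRescale (Real.exp τ) V z.1 z.2 - u z.1 z.2) 3
            (volume.restrict K) ≤ ENNReal.ofReal ε) ∧
        (∀ ε : ℝ, 0 < ε → ∀ K : Set (ℝ × EuclideanSpace ℝ (Fin 3)), IsCompact K → K ⊆ Set.Iic (0 : ℝ) ×ˢ Set.univ →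
          ∃ L : ℝ, 0 < L ∧ ∀ a : ℝ, ∃ σ ∈ Set.Icc a (a + L), ∀ s : ℝ,
            eLpNorm (fun z : ℝ × EuclideanSpace ℝ (Fin 3) =>
                nsRescale (Real.exp σ) (nsRescale (Real.exp s) V) z.1 z.2 - nsRescale (Real.exp s) V z.1 z.2) 3
              (volume.restrict K) ≤ ENNReal.ofReal ε)) →
      ¬ IsBackwardSingularPoint u 0) := by
  intro hAPL u p G C hsw hwg hI hdec hap hnr _hH
  exact hAPL u p G C hsw hwg hI hdec hap hnr

/-- **The hull-canonical parts prove the route target `X`.**  `SensitiveHullLiouville → AlmostPeriodicHullLiouville →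
RDSSLiouvilleInClass → TypeIAncientLiouville`: bridge (`stub_slabProfileOfNonzero`, p139433) → `recurrentReduction_proof` (stmt-1590)
→ periodic case to 8561 (`classicalRepresentative_of_rdssProfile`) → `orbitDichotomy` → hull minimality (`stub_hullMinimal`, p158041)
+ inheritance of almost periods (`stub_hullAlmostPeriodic`, p158194) in the a.p. branch / normalisation (`stub_sensitivityNormalization`,
p152690) + propagation of sensitivity (`stub_hullSensitive`, p159198) in the sensitive branch.  Verbatim the composition
`typeIAncientLiouville_of_line` of skeleton gen c10.2 with its stubs as hypotheses.
[cite: Furstenberg1981, Ch. 1 §4, Thm 1.17; AuslanderYorke1980, Thm 1; AlbrittonBarker2019, Lemma 2.2, Prop. 2.3, §3] -/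
theorem typeIAncientLiouville_of_hullLiouvilleParts :
    (∀ (u : ℝ → EuclideanSpace ℝ (Fin 3) → EuclideanSpace ℝ (Fin 3)) (p : ℝ → EuclideanSpace ℝ (Fin 3) → ℝ) (G : ℝ → EuclideanSpace ℝ (Fin 3) → EuclideanSpace ℝ (Fin 3) →L[ℝ] EuclideanSpace ℝ (Fin 3)) (C : ℝ),
      IsSuitableWeakSolutionOn (slab (EuclideanSpace ℝ (Fin 3)) (Set.Iio 0) isOpen_Iio) 1 0 u p →
      HasWeakSpatialGradientOn (slab (EuclideanSpace ℝ (Fin 3)) (Set.Iio 0) isOpen_Iio) u G →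
      typeIBound (Set.Iio (0 : ℝ) ×ˢ Set.univ) u p G < ⊤ →
      HasTypeITimeDecay C u →
      (∀ ε : ℝ, 0 < ε → ∀ K : Set (ℝ × EuclideanSpace ℝ (Fin 3)), IsCompact K → K ⊆ Set.Iic (0 : ℝ) ×ˢ Set.univ →
        ∃ L : ℝ, 0 < L ∧ ∀ a : ℝ, ∃ σ ∈ Set.Icc a (a + L),
          eLpNorm (fun z : ℝ × EuclideanSpace ℝ (Fin 3) => nsRescale (Real.exp σ) u z.1 z.2 - u z.1 z.2) 3
            (volume.restrict K) ≤ ENNReal.ofReal ε) →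
      (¬ ∃ l : ℝ, 1 < l ∧ ∃ (R : EuclideanSpace ℝ (Fin 3) ≃ₗᵢ[ℝ] EuclideanSpace ℝ (Fin 3)) (ξ : EuclideanSpace ℝ (Fin 3)) (τ : ℝ), τ ≤ 0 ∧
          (fun z : ℝ × EuclideanSpace ℝ (Fin 3) => l • R.symm (u (l ^ 2 * z.1 + τ) (l • R z.2 + ξ)))
            =ᵐ[volume.restrict (Set.Iio (0 : ℝ) ×ˢ Set.univ)] (fun z : ℝ × EuclideanSpace ℝ (Fin 3) => u z.1 z.2)) →
      (∃ δ : ℝ, 0 < δ ∧ ∀ V : ℝ → EuclideanSpace ℝ (Fin 3) → EuclideanSpace ℝ (Fin 3),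
        (∀ R : ℝ, 0 < R → MemLp (uncurry V) 3 (volume.restrict (parabolicCylinder R (0 : ℝ × EuclideanSpace ℝ (Fin 3))))) →
        (∀ ε : ℝ, 0 < ε → ∀ K : Set (ℝ × EuclideanSpace ℝ (Fin 3)), IsCompact K → K ⊆ Set.Iic (0 : ℝ) ×ˢ Set.univ →
          ∃ τ : ℝ, eLpNorm (fun z : ℝ × EuclideanSpace ℝ (Fin 3) => nsRescale (Real.exp τ) u z.1 z.2 - V z.1 z.2) 3
            (volume.restrict K) ≤ ENNReal.ofReal ε) →
        (∀ ε : ℝ, 0 < ε → ∀ K : Set (ℝ × EuclideanSpace ℝ (Fin 3)), IsCompact K → K ⊆ Set.Iic (0 : ℝ) ×ˢ Set.univ →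
          ∃ τ : ℝ, eLpNorm (fun z : ℝ × EuclideanSpace ℝ (Fin 3) => nsRescale (Real.exp τ) V z.1 z.2 - u z.1 z.2) 3
            (volume.restrict K) ≤ ENNReal.ofReal ε) ∧
        (∀ ε : ℝ, 0 < ε → ∀ K : Set (ℝ × EuclideanSpace ℝ (Fin 3)), IsCompact K → K ⊆ Set.Iic (0 : ℝ) ×ˢ Set.univ →
          ∃ σ : ℝ, eLpNorm (fun z : ℝ × EuclideanSpace ℝ (Fin 3) => nsRescale (Real.exp σ) V z.1 z.2 - V z.1 z.2) 3
              (volume.restrict K) ≤ ENNReal.ofReal ε ∧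
            ∃ s : ℝ, ENNReal.ofReal δ < eLpNorm (fun z : ℝ × EuclideanSpace ℝ (Fin 3) =>
                nsRescale (Real.exp σ) (nsRescale (Real.exp s) V) z.1 z.2 - nsRescale (Real.exp s) V z.1 z.2) 3
              (volume.restrict (parabolicCylinder 1 (0 : ℝ × EuclideanSpace ℝ (Fin 3)))))) →
      ¬ IsBackwardSingularPoint u 0) →
    (∀ (u : ℝ → EuclideanSpace ℝ (Fin 3) → EuclideanSpace ℝ (Fin 3)) (p : ℝ → EuclideanSpace ℝ (Fin 3) → ℝ) (G : ℝ → EuclideanSpace ℝ (Fin 3) → EuclideanSpace ℝ (Fin 3) →L[ℝ] EuclideanSpace ℝ (Fin 3)) (C : ℝ),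
      IsSuitableWeakSolutionOn (slab (EuclideanSpace ℝ (Fin 3)) (Set.Iio 0) isOpen_Iio) 1 0 u p →
      HasWeakSpatialGradientOn (slab (EuclideanSpace ℝ (Fin 3)) (Set.Iio 0) isOpen_Iio) u G →
      typeIBound (Set.Iio (0 : ℝ) ×ˢ Set.univ) u p G < ⊤ →
      HasTypeITimeDecay C u →
      (∀ ε : ℝ, 0 < ε → ∀ K : Set (ℝ × EuclideanSpace ℝ (Fin 3)), IsCompact K → K ⊆ Set.Iic (0 : ℝ) ×ˢ Set.univ →
        ∃ L : ℝ, 0 < L ∧ ∀ a : ℝ, ∃ σ ∈ Set.Icc a (a + L), ∀ s : ℝ,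
          eLpNorm (fun z : ℝ × EuclideanSpace ℝ (Fin 3) =>
              nsRescale (Real.exp σ) (nsRescale (Real.exp s) u) z.1 z.2 - nsRescale (Real.exp s) u z.1 z.2) 3
            (volume.restrict K) ≤ ENNReal.ofReal ε) →
      (¬ ∃ l : ℝ, 1 < l ∧ ∃ (R : EuclideanSpace ℝ (Fin 3) ≃ₗᵢ[ℝ] EuclideanSpace ℝ (Fin 3)) (ξ : EuclideanSpace ℝ (Fin 3)) (τ : ℝ), τ ≤ 0 ∧
          (fun z : ℝ × EuclideanSpace ℝ (Fin 3) => l • R.symm (u (l ^ 2 * z.1 + τ) (l • R z.2 + ξ)))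
            =ᵐ[volume.restrict (Set.Iio (0 : ℝ) ×ˢ Set.univ)] (fun z : ℝ × EuclideanSpace ℝ (Fin 3) => u z.1 z.2)) →
      (∀ V : ℝ → EuclideanSpace ℝ (Fin 3) → EuclideanSpace ℝ (Fin 3),
        (∀ R : ℝ, 0 < R → MemLp (uncurry V) 3 (volume.restrict (parabolicCylinder R (0 : ℝ × EuclideanSpace ℝ (Fin 3))))) →
        (∀ ε : ℝ, 0 < ε → ∀ K : Set (ℝ × EuclideanSpace ℝ (Fin 3)), IsCompact K → K ⊆ Set.Iic (0 : ℝ) ×ˢ Set.univ →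
          ∃ τ : ℝ, eLpNorm (fun z : ℝ × EuclideanSpace ℝ (Fin 3) => nsRescale (Real.exp τ) u z.1 z.2 - V z.1 z.2) 3
            (volume.restrict K) ≤ ENNReal.ofReal ε) →
        (∀ ε : ℝ, 0 < ε → ∀ K : Set (ℝ × EuclideanSpace ℝ (Fin 3)), IsCompact K → K ⊆ Set.Iic (0 : ℝ) ×ˢ Set.univ →
          ∃ τ : ℝ, eLpNorm (fun z : ℝ × EuclideanSpace ℝ (Fin 3) => nsRescale (Real.exp τ) V z.1 z.2 - u z.1 z.2) 3
            (volume.restrict K) ≤ ENNReal.ofReal ε) ∧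
        (∀ ε : ℝ, 0 < ε → ∀ K : Set (ℝ × EuclideanSpace ℝ (Fin 3)), IsCompact K → K ⊆ Set.Iic (0 : ℝ) ×ˢ Set.univ →
          ∃ L : ℝ, 0 < L ∧ ∀ a : ℝ, ∃ σ ∈ Set.Icc a (a + L), ∀ s : ℝ,
            eLpNorm (fun z : ℝ × EuclideanSpace ℝ (Fin 3) =>
                nsRescale (Real.exp σ) (nsRescale (Real.exp s) V) z.1 z.2 - nsRescale (Real.exp s) V z.1 z.2) 3
              (volume.restrict K) ≤ ENNReal.ofReal ε)) →
      ¬ IsBackwardSingularPoint u 0) →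
    Summit.NavierStokesRegularity.NavierStokesRegularity.Theses.DulacContraction.RDSSLiouvilleInClass →
    Summit.NavierStokesRegularity.NavierStokesRegularity.Theses.SymmetryModuliCount.TypeIAncientLiouville := by
  intro hSHL hAPHL h8561 C u hu t ht x
  by_contra hx
  have hu' : IsTypeIAncientMild C u := isTypeIAncientMild_iff.2 hu
  obtain ⟨w, q, G, C', hw, hG, hI, hC', hsing⟩ := stub_slabProfileOfNonzero C u hu' ⟨t, ht, x, hx⟩
  obtain ⟨U, P, H, hU, hH, hIU, hCU, hsingU, hrecU⟩ :=
    Summit.NavierStokesRegularity.NavierStokesRegularity.Theorems.recurrentReduction_proof w q G C' hw hG hI hC' hsing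
  -- the periodic case: `U` rotated-discretely self-similar in stmt-8561's sense
  by_cases hper : ∃ l : ℝ, 1 < l ∧ ∃ (R : EuclideanSpace ℝ (Fin 3) ≃ₗᵢ[ℝ] EuclideanSpace ℝ (Fin 3)) (ξ : EuclideanSpace ℝ (Fin 3)) (τ : ℝ), τ ≤ 0 ∧
      (fun z : ℝ × EuclideanSpace ℝ (Fin 3) => l • R.symm (U (l ^ 2 * z.1 + τ) (l • R z.2 + ξ)))
        =ᵐ[volume.restrict (Set.Iio (0 : ℝ) ×ˢ Set.univ)] (fun z : ℝ × EuclideanSpace ℝ (Fin 3) => U z.1 z.2)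
  · obtain ⟨w', q', H', C'', h1, h2, h3, h4, h5, h6, h7⟩ := classicalRepresentative_of_rdssProfile hU hIU hCU hper hsingU
    exact h8561 w' q' H' C'' h1 h2 h3 h4 h5 h6 h7
  -- the aperiodic case: `U ∈ L³_loc`, its hull is minimal
  have hPU : ∀ R : ℝ, 0 < R → MemLp (uncurry U) 3 (volume.restrict (parabolicCylinder R (0 : ℝ × EuclideanSpace ℝ (Fin 3)))) :=
    fun R hR => Summit.NavierStokesRegularity.NavierStokesRegularity.Theorems.memLp_three_of_slabProfile hH hIU hR
  have hmin : ∀ V : ℝ → EuclideanSpace ℝ (Fin 3) → EuclideanSpace ℝ (Fin 3),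
      (∀ R : ℝ, 0 < R → MemLp (uncurry V) 3 (volume.restrict (parabolicCylinder R (0 : ℝ × EuclideanSpace ℝ (Fin 3))))) →
      (∀ ε : ℝ, 0 < ε → ∀ K : Set (ℝ × EuclideanSpace ℝ (Fin 3)), IsCompact K → K ⊆ Set.Iic (0 : ℝ) ×ˢ Set.univ →
        ∃ τ : ℝ, eLpNorm (fun z : ℝ × EuclideanSpace ℝ (Fin 3) => nsRescale (Real.exp τ) U z.1 z.2 - V z.1 z.2) 3
          (volume.restrict K) ≤ ENNReal.ofReal ε) →
      ∀ ε : ℝ, 0 < ε → ∀ K : Set (ℝ × EuclideanSpace ℝ (Fin 3)), IsCompact K → K ⊆ Set.Iic (0 : ℝ) ×ˢ Set.univ →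
        ∃ τ : ℝ, eLpNorm (fun z : ℝ × EuclideanSpace ℝ (Fin 3) => nsRescale (Real.exp τ) V z.1 z.2 - U z.1 z.2) 3
          (volume.restrict K) ≤ ENNReal.ofReal ε :=
    fun V hPV hUV => Summit.NavierStokesRegularity.NavierStokesRegularity.Theorems.stub_hullMinimal U V hPU hPV hrecU hUV
  rcases Summit.NavierStokesRegularity.NavierStokesRegularity.Theorems.SymmetryModuliCountForcedSymmetry.orbitDichotomy U hrecU
    with hap | hsensK
  · refine hAPHL U P H C' hU hH hIU hCU hap hper (fun V hPV hUV => ?_) hsingU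
    exact ⟨hmin V hPV hUV,
      Summit.NavierStokesRegularity.NavierStokesRegularity.Theorems.stub_hullAlmostPeriodic U V hPU hPV hap hUV⟩
  · obtain ⟨δ, hδ, hOS⟩ :=
      Summit.NavierStokesRegularity.NavierStokesRegularity.Theorems.stub_sensitivityNormalization U hsensK
    refine hSHL U P H C' hU hH hIU hCU hrecU hper ⟨δ / 2, by positivity, fun V hPV hUV => ?_⟩ hsingU
    exact ⟨hmin V hPV hUV,
      Summit.NavierStokesRegularity.NavierStokesRegularity.Theorems.stub_hullSensitive U δ hδ hPU hmin hOS V hPV hUV⟩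

/-- **THREE LIOUVILLE THEOREMS, hull-canonical form: `ForcedSymmetry ↔ (SensitiveHullLiouville ∧ AlmostPeriodicHullLiouville ∧
RDSSLiouvilleInClass)`.**  The crux is exactly the conjunction of three Liouville statements for Type-I slab class profiles indexed by
the isomorphism class of the minimal hull of the scaling flow: SENSITIVE minimal hull / EQUICONTINUOUS non-periodic minimal hull /
closed orbit up to rotation ((R)DSS, stmt-8561) — pairwise disjoint single-object refutation witnesses, and no slack: `→` from
`forcedSymmetry_iff_liouvilleParts` (p155499) and the two monotonicity lemmas above, `←` from
`typeIAncientLiouville_of_hullLiouvilleParts` and the collapse `forcedSymmetry_of_typeIAncientLiouville`.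
[cite: AuslanderYorke1980, Thm 1; Furstenberg1981, Ch. 1 §4, Thm 1.17; AlbrittonBarker2019, Thm 1.1, §3] -/
theorem forcedSymmetry_iff_hullLiouvilleParts :
    Summit.NavierStokesRegularity.NavierStokesRegularity.Theses.SymmetryModuliCount.ForcedSymmetry ↔
    ((∀ (u : ℝ → EuclideanSpace ℝ (Fin 3) → EuclideanSpace ℝ (Fin 3)) (p : ℝ → EuclideanSpace ℝ (Fin 3) → ℝ) (G : ℝ → EuclideanSpace ℝ (Fin 3) → EuclideanSpace ℝ (Fin 3) →L[ℝ] EuclideanSpace ℝ (Fin 3)) (C : ℝ),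
      IsSuitableWeakSolutionOn (slab (EuclideanSpace ℝ (Fin 3)) (Set.Iio 0) isOpen_Iio) 1 0 u p →
      HasWeakSpatialGradientOn (slab (EuclideanSpace ℝ (Fin 3)) (Set.Iio 0) isOpen_Iio) u G →
      typeIBound (Set.Iio (0 : ℝ) ×ˢ Set.univ) u p G < ⊤ →
      HasTypeITimeDecay C u →
      (∀ ε : ℝ, 0 < ε → ∀ K : Set (ℝ × EuclideanSpace ℝ (Fin 3)), IsCompact K → K ⊆ Set.Iic (0 : ℝ) ×ˢ Set.univ →
        ∃ L : ℝ, 0 < L ∧ ∀ a : ℝ, ∃ σ ∈ Set.Icc a (a + L),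
          eLpNorm (fun z : ℝ × EuclideanSpace ℝ (Fin 3) => nsRescale (Real.exp σ) u z.1 z.2 - u z.1 z.2) 3
            (volume.restrict K) ≤ ENNReal.ofReal ε) →
      (¬ ∃ l : ℝ, 1 < l ∧ ∃ (R : EuclideanSpace ℝ (Fin 3) ≃ₗᵢ[ℝ] EuclideanSpace ℝ (Fin 3)) (ξ : EuclideanSpace ℝ (Fin 3)) (τ : ℝ), τ ≤ 0 ∧
          (fun z : ℝ × EuclideanSpace ℝ (Fin 3) => l • R.symm (u (l ^ 2 * z.1 + τ) (l • R z.2 + ξ)))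
            =ᵐ[volume.restrict (Set.Iio (0 : ℝ) ×ˢ Set.univ)] (fun z : ℝ × EuclideanSpace ℝ (Fin 3) => u z.1 z.2)) →
      (∃ δ : ℝ, 0 < δ ∧ ∀ V : ℝ → EuclideanSpace ℝ (Fin 3) → EuclideanSpace ℝ (Fin 3),
        (∀ R : ℝ, 0 < R → MemLp (uncurry V) 3 (volume.restrict (parabolicCylinder R (0 : ℝ × EuclideanSpace ℝ (Fin 3))))) →
        (∀ ε : ℝ, 0 < ε → ∀ K : Set (ℝ × EuclideanSpace ℝ (Fin 3)), IsCompact K → K ⊆ Set.Iic (0 : ℝ) ×ˢ Set.univ →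
          ∃ τ : ℝ, eLpNorm (fun z : ℝ × EuclideanSpace ℝ (Fin 3) => nsRescale (Real.exp τ) u z.1 z.2 - V z.1 z.2) 3
            (volume.restrict K) ≤ ENNReal.ofReal ε) →
        (∀ ε : ℝ, 0 < ε → ∀ K : Set (ℝ × EuclideanSpace ℝ (Fin 3)), IsCompact K → K ⊆ Set.Iic (0 : ℝ) ×ˢ Set.univ →
          ∃ τ : ℝ, eLpNorm (fun z : ℝ × EuclideanSpace ℝ (Fin 3) => nsRescale (Real.exp τ) V z.1 z.2 - u z.1 z.2) 3
            (volume.restrict K) ≤ ENNReal.ofReal ε) ∧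
        (∀ ε : ℝ, 0 < ε → ∀ K : Set (ℝ × EuclideanSpace ℝ (Fin 3)), IsCompact K → K ⊆ Set.Iic (0 : ℝ) ×ˢ Set.univ →
          ∃ σ : ℝ, eLpNorm (fun z : ℝ × EuclideanSpace ℝ (Fin 3) => nsRescale (Real.exp σ) V z.1 z.2 - V z.1 z.2) 3
              (volume.restrict K) ≤ ENNReal.ofReal ε ∧
            ∃ s : ℝ, ENNReal.ofReal δ < eLpNorm (fun z : ℝ × EuclideanSpace ℝ (Fin 3) =>
                nsRescale (Real.exp σ) (nsRescale (Real.exp s) V) z.1 z.2 - nsRescale (Real.exp s) V z.1 z.2) 3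
              (volume.restrict (parabolicCylinder 1 (0 : ℝ × EuclideanSpace ℝ (Fin 3)))))) →
      ¬ IsBackwardSingularPoint u 0) ∧
    (∀ (u : ℝ → EuclideanSpace ℝ (Fin 3) → EuclideanSpace ℝ (Fin 3)) (p : ℝ → EuclideanSpace ℝ (Fin 3) → ℝ) (G : ℝ → EuclideanSpace ℝ (Fin 3) → EuclideanSpace ℝ (Fin 3) →L[ℝ] EuclideanSpace ℝ (Fin 3)) (C : ℝ),
      IsSuitableWeakSolutionOn (slab (EuclideanSpace ℝ (Fin 3)) (Set.Iio 0) isOpen_Iio) 1 0 u p →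
      HasWeakSpatialGradientOn (slab (EuclideanSpace ℝ (Fin 3)) (Set.Iio 0) isOpen_Iio) u G →
      typeIBound (Set.Iio (0 : ℝ) ×ˢ Set.univ) u p G < ⊤ →
      HasTypeITimeDecay C u →
      (∀ ε : ℝ, 0 < ε → ∀ K : Set (ℝ × EuclideanSpace ℝ (Fin 3)), IsCompact K → K ⊆ Set.Iic (0 : ℝ) ×ˢ Set.univ →
        ∃ L : ℝ, 0 < L ∧ ∀ a : ℝ, ∃ σ ∈ Set.Icc a (a + L), ∀ s : ℝ,
          eLpNorm (fun z : ℝ × EuclideanSpace ℝ (Fin 3) =>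
              nsRescale (Real.exp σ) (nsRescale (Real.exp s) u) z.1 z.2 - nsRescale (Real.exp s) u z.1 z.2) 3
            (volume.restrict K) ≤ ENNReal.ofReal ε) →
      (¬ ∃ l : ℝ, 1 < l ∧ ∃ (R : EuclideanSpace ℝ (Fin 3) ≃ₗᵢ[ℝ] EuclideanSpace ℝ (Fin 3)) (ξ : EuclideanSpace ℝ (Fin 3)) (τ : ℝ), τ ≤ 0 ∧
          (fun z : ℝ × EuclideanSpace ℝ (Fin 3) => l • R.symm (u (l ^ 2 * z.1 + τ) (l • R z.2 + ξ)))
            =ᵐ[volume.restrict (Set.Iio (0 : ℝ) ×ˢ Set.univ)] (fun z : ℝ × EuclideanSpace ℝ (Fin 3) => u z.1 z.2)) →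
      (∀ V : ℝ → EuclideanSpace ℝ (Fin 3) → EuclideanSpace ℝ (Fin 3),
        (∀ R : ℝ, 0 < R → MemLp (uncurry V) 3 (volume.restrict (parabolicCylinder R (0 : ℝ × EuclideanSpace ℝ (Fin 3))))) →
        (∀ ε : ℝ, 0 < ε → ∀ K : Set (ℝ × EuclideanSpace ℝ (Fin 3)), IsCompact K → K ⊆ Set.Iic (0 : ℝ) ×ˢ Set.univ →
          ∃ τ : ℝ, eLpNorm (fun z : ℝ × EuclideanSpace ℝ (Fin 3) => nsRescale (Real.exp τ) u z.1 z.2 - V z.1 z.2) 3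
            (volume.restrict K) ≤ ENNReal.ofReal ε) →
        (∀ ε : ℝ, 0 < ε → ∀ K : Set (ℝ × EuclideanSpace ℝ (Fin 3)), IsCompact K → K ⊆ Set.Iic (0 : ℝ) ×ˢ Set.univ →
          ∃ τ : ℝ, eLpNorm (fun z : ℝ × EuclideanSpace ℝ (Fin 3) => nsRescale (Real.exp τ) V z.1 z.2 - u z.1 z.2) 3
            (volume.restrict K) ≤ ENNReal.ofReal ε) ∧
        (∀ ε : ℝ, 0 < ε → ∀ K : Set (ℝ × EuclideanSpace ℝ (Fin 3)), IsCompact K → K ⊆ Set.Iic (0 : ℝ) ×ˢ Set.univ →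
          ∃ L : ℝ, 0 < L ∧ ∀ a : ℝ, ∃ σ ∈ Set.Icc a (a + L), ∀ s : ℝ,
            eLpNorm (fun z : ℝ × EuclideanSpace ℝ (Fin 3) =>
                nsRescale (Real.exp σ) (nsRescale (Real.exp s) V) z.1 z.2 - nsRescale (Real.exp s) V z.1 z.2) 3
              (volume.restrict K) ≤ ENNReal.ofReal ε)) →
      ¬ IsBackwardSingularPoint u 0) ∧
    Summit.NavierStokesRegularity.NavierStokesRegularity.Theses.DulacContraction.RDSSLiouvilleInClass) := by
  constructor
  · intro hFS
    obtain ⟨hSL, hAPL, h8561⟩ := forcedSymmetry_iff_liouvilleParts.1 hFS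
    exact ⟨sensitiveHullLiouville_of_sensitiveLiouville hSL, almostPeriodicHullLiouville_of_almostPeriodicLiouville hAPL, h8561⟩
  · rintro ⟨hSHL, hAPHL, h8561⟩
    exact forcedSymmetry_of_typeIAncientLiouville (typeIAncientLiouville_of_hullLiouvilleParts hSHL hAPHL h8561)

end Summit.NavierStokesRegularity.NavierStokesRegularity.Theorems.SymmetryModuliCountForcedSymmetry

end
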